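import Literature.Probability.RandomPlanarGeometry.SAWPulledLargeForceExpansionZdWordTypes
import HarnessLib

/-!
# Axis types of length six: the transversal `T6` (203 set partitions × 64 sign vectors = 12 992 types) and cheap Boolean block tests

Topic `Literature/Probability/RandomPlanarGeometry` (continuation of `…ZdWordTypes`: the data needed to run the master formula
`WordTypes.card_filter_eq_sum_transversal` at word length 6 — the length of the transverse words of the cost-8 length-10 layer
(«ZD-FOUR-SLACK-TWO»)). [cite: MadrasSlade1993, Definition 1.2.4]

Everything structural: RESTRICTED GROWTH of the axis sequence characterises the canonical words (`growthOK_iff_canon_eq`, via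
`nf`/`rank` bookkeeping and `exists_first_of_lt_nf`), so the transversal `T6` is cut out of the 46 080-tuple box `Box6` (letters of
axis `≤ position`) by a cheap decidable test; COMPLETENESS (`canon_mem_T6`) and the total-size identity (`count_T6`) are theorems, not
enumerations; the master formula at length 6 is `card_filter_eq_sum_T6`.  No kernel enumeration anywhere in this file
(`T6` has 12 992 = Bell(6)·2⁶ elements; the census cells that enumerate it live in the sequel).
The definitions `Box6`, `ofBox6`, `nf`, `pm`, `GrowthOK`, `AxFixed`, `boxT6`, `T6`, `boxOf` are this file's tool notions (not notions in
print).  No number is taken from print.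

Provenance: lane «pcv-sawmu», a-p3 g18 (2026-08-25).
-/

open Finset
open scoped BigOperators
open Literature.Probability.LatticeModels
open Literature.Probability.RandomPlanarGeometry.SAW

namespace Literature.Probability.RandomPlanarGeometry.SAW.Zd

namespace WordTypes

/-- The length-6 box: the letter at position `i` has axis `< i+1`. [cite: MadrasSlade1993, Definition 1.2.4] -/
abbrev Box6 : Type := (Fin 1 × Bool) × (Fin 2 × Bool) × (Fin 3 × Bool) × (Fin 4 × Bool) × (Fin 5 × Bool) × (Fin 6 × Bool)

/-- The word of a box tuple. [cite: MadrasSlade1993, Definition 1.2.4] -/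
def ofBox6 (t : Box6) : Word 6 6 :=
  ![(Fin.castLE (by omega) t.1.1, t.1.2), (Fin.castLE (by omega) t.2.1.1, t.2.1.2), (Fin.castLE (by omega) t.2.2.1.1, t.2.2.1.2),
    (Fin.castLE (by omega) t.2.2.2.1.1, t.2.2.2.1.2), (Fin.castLE (by omega) t.2.2.2.2.1.1, t.2.2.2.2.1.2), t.2.2.2.2.2]

/-- `ofBox6` is injective. [cite: MadrasSlade1993, Definition 1.2.4] -/
theorem ofBox6_injective : Function.Injective ofBox6 := by
  intro t t' h
  have h0 := congrFun h 0
  have h1 := congrFun h 1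
  have h2 := congrFun h 2
  have h3 := congrFun h 3
  have h4 := congrFun h 4
  have h5 := congrFun h 5
  simp only [ofBox6, Matrix.cons_val_zero, Matrix.cons_val_one, Matrix.cons_val, Prod.mk.injEq, Fin.castLE_inj] at h0 h1 h2 h3 h4 h5
  obtain ⟨⟨a0, b0⟩, ⟨a1, b1⟩, ⟨a2, b2⟩, ⟨a3, b3⟩, ⟨a4, b4⟩, ⟨a5, b5⟩⟩ := t
  obtain ⟨⟨a0', b0'⟩, ⟨a1', b1'⟩, ⟨a2', b2'⟩, ⟨a3', b3'⟩, ⟨a4', b4'⟩, ⟨a5', b5'⟩⟩ := t'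
  simp only at h0 h1 h2 h3 h4 h5
  obtain ⟨rfl, rfl⟩ := h0
  obtain ⟨rfl, rfl⟩ := h1
  obtain ⟨rfl, rfl⟩ := h2
  obtain ⟨rfl, rfl⟩ := h3
  obtain ⟨rfl, rfl⟩ := h4
  obtain ⟨rfl, rfl⟩ := h5
  rfl

/-! ### Restricted growth: the cheap characterisation of canonical words

For a word `u`, `nf u p` is the number of first occurrences before position `p` and `pm u p = max_{q<p} (axis(u q) + 1)` (`0` if
`p = 0`).  A word is its own canonical representative iff its axis sequence has RESTRICTED GROWTH: `axis(u p) ≤ pm u p` for all `p`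
(`growthOK_iff_canon_eq`).  The growth condition is cheap to decide, so the transversal of length 6 can be cut out of the box by it. -/

section rgs

variable {L d : ℕ}

/-- Number of first occurrences strictly before position `p`. [cite: MadrasSlade1993, Definition 1.2.4] -/
def nf (u : Word L d) (p : Fin L) : ℕ := ((firsts u).filter fun q => q < p).card

/-- `rank u p = nf u (firstOcc u p)`. [cite: MadrasSlade1993, Definition 1.2.4] -/
theorem rank_eq_nf (u : Word L d) (p : Fin L) : rank u p = nf u (firstOcc u p) := rfl

/-- `nf` is monotone. [cite: MadrasSlade1993, Definition 1.2.4] -/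
theorem nf_mono (u : Word L d) {p q : Fin L} (h : p ≤ q) : nf u p ≤ nf u q :=
  Finset.card_le_card fun _ hx => Finset.mem_filter.2 ⟨(Finset.mem_filter.1 hx).1, lt_of_lt_of_le (Finset.mem_filter.1 hx).2 h⟩

/-- `nf u p ≤ p`. [cite: MadrasSlade1993, Definition 1.2.4] -/
theorem nf_le (u : Word L d) (p : Fin L) : nf u p ≤ p.val := by
  unfold nf
  have hI : (Finset.univ.filter fun q : Fin L => q < p) = Finset.Iio p := by
    ext q; simp
  calc ((firsts u).filter fun q => q < p).card ≤ (Finset.univ.filter fun q : Fin L => q < p).card :=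
        Finset.card_le_card fun _ hx => Finset.mem_filter.2 ⟨Finset.mem_univ _, (Finset.mem_filter.1 hx).2⟩
    _ = p.val := by rw [hI, Fin.card_Iio]

/-- `rank u p ≤ nf u p`. [cite: MadrasSlade1993, Definition 1.2.4] -/
theorem rank_le_nf (u : Word L d) (p : Fin L) : rank u p ≤ nf u p := by
  rw [rank_eq_nf]; exact nf_mono u (firstOcc_le u rfl)

/-- A first occurrence `q < p` has `rank u q < nf u p`. [cite: MadrasSlade1993, Definition 1.2.4] -/
theorem rank_lt_nf {u : Word L d} {p q : Fin L} (hq : IsFirst u q) (hqp : q < p) : rank u q < nf u p := by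
  rw [rank_eq_nf, firstOcc_eq_self u hq]
  unfold nf
  apply Finset.card_lt_card
  refine (Finset.ssubset_iff_of_subset fun x hx => Finset.mem_filter.2
    ⟨(Finset.mem_filter.1 hx).1, lt_trans (Finset.mem_filter.1 hx).2 hqp⟩).2 ⟨q, ?_, ?_⟩
  · exact Finset.mem_filter.2 ⟨Finset.mem_filter.2 ⟨Finset.mem_univ _, hq⟩, hqp⟩
  · rw [Finset.mem_filter]; exact fun h => lt_irrefl _ h.2

/-- `rank u p < nf u q` whenever `p < q` (the axis of `p` first occurs before `q`). [cite: MadrasSlade1993, Definition 1.2.4] -/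
theorem rank_lt_nf_of_lt (u : Word L d) {p q : Fin L} (hpq : p < q) : rank u p < nf u q := by
  have h := rank_lt_nf (isFirst_firstOcc u p) (lt_of_le_of_lt (firstOcc_le u rfl) hpq)
  rwa [rank_eq_nf, firstOcc_eq_self u (isFirst_firstOcc u p), ← rank_eq_nf] at h

/-- The ranks of the first occurrences before `p` are exactly `0, …, nf u p − 1`. [cite: MadrasSlade1993, Definition 1.2.4] -/
theorem exists_first_of_lt_nf (u : Word L d) (p : Fin L) {i : ℕ} (hi : i < nf u p) :
    ∃ q : Fin L, IsFirst u q ∧ q < p ∧ rank u q = i := by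
  classical
  -- `rank` maps the first occurrences before `p` injectively into `range (nf u p)`; the cardinalities agree
  set S := (firsts u).filter fun q => q < p with hS
  have hinj : Set.InjOn (rank u) S := by
    intro q hq q' hq' h
    have hq1 := (Finset.mem_filter.1 (Finset.mem_filter.1 hq).1).2
    have hq1' := (Finset.mem_filter.1 (Finset.mem_filter.1 hq').1).2
    have := (rank_eq_rank_iff u q q').1 h
    exact hq1.eq_of_axis_eq hq1' this
  have hsub : S.image (rank u) ⊆ Finset.range (nf u p) := by
    intro i hi'
    obtain ⟨q, hq, rfl⟩ := Finset.mem_image.1 hi'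
    exact Finset.mem_range.2 (rank_lt_nf (Finset.mem_filter.1 (Finset.mem_filter.1 hq).1).2 (Finset.mem_filter.1 hq).2)
  have hcard : (S.image (rank u)).card = (Finset.range (nf u p)).card := by
    rw [Finset.card_image_of_injOn hinj, Finset.card_range]
    rfl
  have heq : S.image (rank u) = Finset.range (nf u p) := Finset.eq_of_subset_of_card_le hsub hcard.ge
  have hmem : i ∈ S.image (rank u) := by rw [heq]; exact Finset.mem_range.2 hi
  obtain ⟨q, hq, hqi⟩ := Finset.mem_image.1 hmem
  exact ⟨q, (Finset.mem_filter.1 (Finset.mem_filter.1 hq).1).2, (Finset.mem_filter.1 hq).2, hqi⟩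

/-- `pm u p = max_{q < p} (axis(u q) + 1)` (`0` for `p = 0`). [cite: MadrasSlade1993, Definition 1.2.4] -/
def pm (u : Word L d) (p : Fin L) : ℕ := (Finset.univ.filter fun q : Fin L => q < p).sup fun q => (u q).1.val + 1

/-- Restricted growth of the axis sequence. [cite: MadrasSlade1993, Definition 1.2.4] -/
def GrowthOK (u : Word L d) : Prop := ∀ p : Fin L, (u p).1.val ≤ pm u p

/-- `GrowthOK` is decidable. [cite: MadrasSlade1993, Definition 1.2.4] -/
instance (u : Word L d) : Decidable (GrowthOK u) := by unfold GrowthOK; infer_instance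

/-- The axes are their own ranks. [cite: MadrasSlade1993, Definition 1.2.4] -/
def AxFixed (u : Word L d) : Prop := ∀ p : Fin L, (u p).1.val = rank u p

/-- Axis-fixed words have restricted growth. [cite: MadrasSlade1993, Definition 1.2.4] -/
theorem AxFixed.growthOK {u : Word L d} (h : AxFixed u) : GrowthOK u := by
  intro p
  rw [h p]
  refine (rank_le_nf u p).trans ?_
  -- `nf u p ≤ pm u p`: the last first occurrence before `p` has rank `nf u p − 1`
  rcases Nat.eq_zero_or_pos (nf u p) with h0 | hpos
  · rw [h0]; exact Nat.zero_le _
  · obtain ⟨q, hq, hqp, hr⟩ := exists_first_of_lt_nf u p (Nat.sub_lt hpos Nat.one_pos)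
    have : (u q).1.val + 1 = nf u p := by rw [h q, hr]; omega
    rw [← this]
    exact Finset.le_sup (f := fun q => (u q).1.val + 1) (Finset.mem_filter.2 ⟨Finset.mem_univ _, hqp⟩)

/-- Restricted growth forces the axes to be their ranks. [cite: MadrasSlade1993, Definition 1.2.4] -/
theorem GrowthOK.axFixed {u : Word L d} (h : GrowthOK u) : AxFixed u := by
  suffices H : ∀ n : ℕ, ∀ p : Fin L, p.val < n → (u p).1.val = rank u p from fun p => H _ p (Nat.lt_succ_self _)
  intro n
  induction n with
  | zero => intro p hp; exact absurd hp (Nat.not_lt_zero _)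
  | succ n ih =>
    intro p hp
    have IH : ∀ q : Fin L, q < p → (u q).1.val = rank u q :=
      fun q hq => ih q (lt_of_lt_of_le (Fin.lt_def.1 hq) (Nat.lt_succ_iff.1 hp))
    by_cases hf : IsFirst u p
    · have hr : rank u p = nf u p := by rw [rank_eq_nf, firstOcc_eq_self u hf]
      apply le_antisymm
      · refine (h p).trans ?_
        rw [hr]
        apply Finset.sup_le
        intro q hq
        have hqp : q < p := (Finset.mem_filter.1 hq).2
        show (u q).1.val + 1 ≤ nf u p
        rw [IH q hqp]
        exact rank_lt_nf_of_lt u hqp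
      · by_contra hlt
        push Not at hlt
        rw [hr] at hlt
        obtain ⟨q, hq, hqp, hrq⟩ := exists_first_of_lt_nf u p hlt
        have hax : (u q).1 = (u p).1 := Fin.ext (by rw [IH q hqp, hrq])
        exact hf q hqp hax
    · have hle : firstOcc u p ≤ p := firstOcc_le u rfl
      have hlt : firstOcc u p < p := lt_of_le_of_ne hle fun he => hf (he ▸ isFirst_firstOcc u p)
      have e1 : (u p).1 = (u (firstOcc u p)).1 := (axis_firstOcc u p).symm
      rw [e1, IH _ hlt]
      exact (rank_eq_rank_iff u _ _).2 (axis_firstOcc u p)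

/-- ★ Restricted growth ⇔ the axes are their own ranks. [cite: MadrasSlade1993, Definition 1.2.4] -/
theorem growthOK_iff_axFixed (u : Word L d) : GrowthOK u ↔ AxFixed u := ⟨GrowthOK.axFixed, AxFixed.growthOK⟩

/-- For words over `Idx L`: axis-fixed ⇔ fixed by `canon`. [cite: MadrasSlade1993, Definition 1.2.4] -/
theorem axFixed_iff_canon_eq (u : Word L L) : AxFixed u ↔ canon u = u := by
  constructor
  · intro h
    funext p
    exact Prod.ext (Fin.ext (h p).symm) rfl
  · intro h p
    have := congrArg (fun w : Word L L => (w p).1.val) h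
    exact this.symm

/-- ★ Restricted growth ⇔ canonical (for words over `Idx L`). [cite: MadrasSlade1993, Definition 1.2.4] -/
theorem growthOK_iff_canon_eq (u : Word L L) : GrowthOK u ↔ canon u = u :=
  (growthOK_iff_axFixed u).trans (axFixed_iff_canon_eq u)

/-- The canonical representative is axis-fixed. [cite: MadrasSlade1993, Definition 1.2.4] -/
theorem axFixed_canon (u : Word L d) : AxFixed (canon u) := fun p => (sameType_canon u).rank_eq p

/-- `rank u p ≤ p`. [cite: MadrasSlade1993, Definition 1.2.4] -/
theorem rank_le_pos (u : Word L d) (p : Fin L) : rank u p ≤ p.val := (rank_le_nf u p).trans (nf_le u p)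

end rgs

/-! ### The transversal of length 6 -/

/-- Restricted growth written on the raw projections of a box tuple (the cheap test the kernel evaluates).
[cite: MadrasSlade1993, Definition 1.2.4] -/
def CanonB (t : Box6) : Prop :=
  t.1.1.val ≤ 0 ∧ t.2.1.1.val ≤ t.1.1.val + 1 ∧ t.2.2.1.1.val ≤ (t.1.1.val + 1) ⊔ (t.2.1.1.val + 1) ∧
    t.2.2.2.1.1.val ≤ (t.1.1.val + 1) ⊔ ((t.2.1.1.val + 1) ⊔ (t.2.2.1.1.val + 1)) ∧
    t.2.2.2.2.1.1.val ≤ (t.1.1.val + 1) ⊔ ((t.2.1.1.val + 1) ⊔ ((t.2.2.1.1.val + 1) ⊔ (t.2.2.2.1.1.val + 1))) ∧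
    t.2.2.2.2.2.1.val ≤ (t.1.1.val + 1) ⊔ ((t.2.1.1.val + 1) ⊔ ((t.2.2.1.1.val + 1) ⊔ ((t.2.2.2.1.1.val + 1) ⊔
      (t.2.2.2.2.1.1.val + 1))))

/-- `CanonB` is decidable. [cite: MadrasSlade1993, Definition 1.2.4] -/
instance (t : Box6) : Decidable (CanonB t) := by unfold CanonB; infer_instance

/-- The raw test is restricted growth of the word. [cite: MadrasSlade1993, Definition 1.2.4] -/
theorem canonB_iff (t : Box6) : CanonB t ↔ GrowthOK (ofBox6 t) := by
  have f0 : (Finset.univ.filter fun q : Fin 6 => q < 0) = ∅ := by decide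
  have f1 : (Finset.univ.filter fun q : Fin 6 => q < 1) = {0} := by decide
  have f2 : (Finset.univ.filter fun q : Fin 6 => q < 2) = {0, 1} := by decide
  have f3 : (Finset.univ.filter fun q : Fin 6 => q < 3) = {0, 1, 2} := by decide
  have f4 : (Finset.univ.filter fun q : Fin 6 => q < 4) = {0, 1, 2, 3} := by decide
  have f5 : (Finset.univ.filter fun q : Fin 6 => q < 5) = {0, 1, 2, 3, 4} := by decide
  have e0 : (ofBox6 t 0).1.val = t.1.1.val := by simp [ofBox6]
  have e1 : (ofBox6 t 1).1.val = t.2.1.1.val := by simp [ofBox6]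
  have e2 : (ofBox6 t 2).1.val = t.2.2.1.1.val := by simp [ofBox6]
  have e3 : (ofBox6 t 3).1.val = t.2.2.2.1.1.val := by simp [ofBox6]
  have e4 : (ofBox6 t 4).1.val = t.2.2.2.2.1.1.val := by simp [ofBox6]
  have e5 : (ofBox6 t 5).1.val = t.2.2.2.2.2.1.val := by simp [ofBox6]
  have p0 : pm (ofBox6 t) 0 = 0 := by rw [pm, f0, Finset.sup_empty]; rfl
  have p1 : pm (ofBox6 t) 1 = t.1.1.val + 1 := by rw [pm, f1, Finset.sup_singleton, e0]
  have p2 : pm (ofBox6 t) 2 = (t.1.1.val + 1) ⊔ (t.2.1.1.val + 1) := by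
    rw [pm, f2, Finset.sup_insert, Finset.sup_singleton, e0, e1]
  have p3 : pm (ofBox6 t) 3 = (t.1.1.val + 1) ⊔ ((t.2.1.1.val + 1) ⊔ (t.2.2.1.1.val + 1)) := by
    rw [pm, f3, Finset.sup_insert, Finset.sup_insert, Finset.sup_singleton, e0, e1, e2]
  have p4 : pm (ofBox6 t) 4 = (t.1.1.val + 1) ⊔ ((t.2.1.1.val + 1) ⊔ ((t.2.2.1.1.val + 1) ⊔ (t.2.2.2.1.1.val + 1))) := by
    rw [pm, f4, Finset.sup_insert, Finset.sup_insert, Finset.sup_insert, Finset.sup_singleton, e0, e1, e2, e3]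
  have p5 : pm (ofBox6 t) 5 = (t.1.1.val + 1) ⊔ ((t.2.1.1.val + 1) ⊔ ((t.2.2.1.1.val + 1) ⊔ ((t.2.2.2.1.1.val + 1) ⊔
      (t.2.2.2.2.1.1.val + 1)))) := by
    rw [pm, f5, Finset.sup_insert, Finset.sup_insert, Finset.sup_insert, Finset.sup_insert, Finset.sup_singleton, e0, e1, e2,
      e3, e4]
  unfold CanonB GrowthOK
  rw [Fin.forall_fin_succ, Fin.forall_fin_succ, Fin.forall_fin_succ, Fin.forall_fin_succ, Fin.forall_fin_succ, Fin.forall_fin_one]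
  show _ ↔ ((ofBox6 t 0).1.val ≤ pm (ofBox6 t) 0 ∧ (ofBox6 t 1).1.val ≤ pm (ofBox6 t) 1 ∧ (ofBox6 t 2).1.val ≤ pm (ofBox6 t) 2 ∧
    (ofBox6 t 3).1.val ≤ pm (ofBox6 t) 3 ∧ (ofBox6 t 4).1.val ≤ pm (ofBox6 t) 4 ∧ (ofBox6 t 5).1.val ≤ pm (ofBox6 t) 5)
  rw [e0, e1, e2, e3, e4, e5, p0, p1, p2, p3, p4, p5]

/-- The canonical box tuples: restricted growth, decided on the raw projections. [cite: MadrasSlade1993, Definition 1.2.4] -/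
def boxT6 : Finset Box6 := Finset.univ.filter fun t => CanonB t

/-- Membership in `boxT6` is restricted growth of the word. [cite: MadrasSlade1993, Definition 1.2.4] -/
theorem mem_boxT6 (t : Box6) : t ∈ boxT6 ↔ GrowthOK (ofBox6 t) := by
  rw [boxT6, Finset.mem_filter, canonB_iff]
  exact ⟨fun h => h.2, fun h => ⟨Finset.mem_univ _, h⟩⟩

/-- The transversal of length 6 (one canonical word per axis type; 12 992 of them). [cite: MadrasSlade1993, Definition 1.2.4] -/
def T6 : Finset (Word 6 6) := boxT6.map ⟨ofBox6, ofBox6_injective⟩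

/-- Counting inside `T6` = counting canonical box tuples. [cite: MadrasSlade1993, Definition 1.2.4] -/
theorem card_filter_T6 (P : Word 6 6 → Prop) [DecidablePred P] :
    (T6.filter P).card = (boxT6.filter fun t => P (ofBox6 t)).card := by
  rw [T6, Finset.filter_map, Finset.card_map]
  rfl

/-- Every word of `T6` is canonical. [cite: MadrasSlade1993, Definition 1.2.4] -/
theorem canon_T6 : ∀ τ ∈ T6, canon τ = τ := by
  intro τ hτ
  obtain ⟨t, ht, rfl⟩ := Finset.mem_map.1 hτ
  exact (growthOK_iff_canon_eq _).1 ((mem_boxT6 t).1 ht)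

/-- The box tuple of the canonical representative of a word of length 6. [cite: MadrasSlade1993, Definition 1.2.4] -/
def boxOf {d : ℕ} (u : Word 6 d) : Box6 :=
  ((⟨rank u 0, Nat.lt_succ_of_le (rank_le_pos u 0)⟩, (u 0).2),
    (⟨rank u 1, Nat.lt_succ_of_le (rank_le_pos u 1)⟩, (u 1).2),
    (⟨rank u 2, Nat.lt_succ_of_le (rank_le_pos u 2)⟩, (u 2).2),
    (⟨rank u 3, Nat.lt_succ_of_le (rank_le_pos u 3)⟩, (u 3).2),
    (⟨rank u 4, Nat.lt_succ_of_le (rank_le_pos u 4)⟩, (u 4).2),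
    (⟨rank u 5, Nat.lt_succ_of_le (rank_le_pos u 5)⟩, (u 5).2))

/-- `ofBox6 (boxOf u) = canon u`. [cite: MadrasSlade1993, Definition 1.2.4] -/
theorem ofBox6_boxOf {d : ℕ} (u : Word 6 d) : ofBox6 (boxOf u) = canon u := by
  funext p
  fin_cases p <;> exact Prod.ext (Fin.ext rfl) rfl

/-- ★ COMPLETENESS: the canonical representative of every word of length 6 lies in `T6`. [cite: MadrasSlade1993, Definition 1.2.4] -/
theorem canon_mem_T6 {d : ℕ} (u : Word 6 d) : canon u ∈ T6 := by
  rw [T6, Finset.mem_map]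
  refine ⟨boxOf u, (mem_boxT6 _).2 ?_, ofBox6_boxOf u⟩
  rw [ofBox6_boxOf]
  exact (axFixed_canon u).growthOK

/-- ★ The classes of `T6` exhaust `Word 6 d`: total size `(2d)⁶` — derived from completeness and canonicity, no enumeration.
[cite: MadrasSlade1993, Definition 1.2.4] -/
theorem count_T6 (d : ℕ) : ∑ τ ∈ T6, d.descFactorial (numAxes τ) = (2 * d) ^ 6 := by
  classical
  have hdisj : (T6 : Set (Word 6 6)).PairwiseDisjoint fun τ => Finset.univ.filter fun u : Word 6 d => SameType u τ := by
    intro τ hτ τ' hτ' hne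
    refine Finset.disjoint_left.2 fun u hu hu' => hne ?_
    have h1 : SameType u τ := (Finset.mem_filter.1 hu).2
    have h2 : SameType u τ' := (Finset.mem_filter.1 hu').2
    rw [← canon_T6 τ hτ, ← canon_T6 τ' hτ']
    exact (h1.symm.trans h2).canon_eq
  have hunion : T6.biUnion (fun τ => Finset.univ.filter fun u : Word 6 d => SameType u τ) = Finset.univ := by
    apply Finset.eq_univ_of_forall
    intro u
    rw [Finset.mem_biUnion]
    exact ⟨canon u, canon_mem_T6 u, Finset.mem_filter.2 ⟨Finset.mem_univ _, sameType_canon u⟩⟩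
  have := congrArg Finset.card hunion
  rw [Finset.card_biUnion hdisj, Finset.card_univ, card_word] at this
  rw [← this]
  exact Finset.sum_congr rfl fun τ _ => (card_filter_sameType τ d).symm

/-- ★ MASTER FORMULA AT LENGTH 6: a type-invariant count over `Word 6 d` is `Σ_{τ ∈ T6} [Q₀ τ] · d^{(numAxes τ)}`.
[cite: MadrasSlade1993, Definition 1.2.4] -/
theorem card_filter_eq_sum_T6 {d : ℕ} (Q : Word 6 d → Prop) [DecidablePred Q] (Q₀ : Word 6 6 → Prop) [DecidablePred Q₀]
    (hQ : ∀ u : Word 6 d, Q u ↔ Q₀ (canon u)) :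
    (Finset.univ.filter Q).card = ∑ τ ∈ T6, if Q₀ τ then d.descFactorial (numAxes τ) else 0 :=
  card_filter_eq_sum_transversal T6 canon_T6 (count_T6 d) Q Q₀ hQ


end WordTypes

end Literature.Probability.RandomPlanarGeometry.SAW.Zd
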